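import Summits.Ventures.LatticeQCDFlow.Scoring.SU2OpenRectangleWilsonLoops
import Summits.Ventures.LatticeQCDFlow.Scoring.SU2TorusReferenceEnclosures
import HarnessLib

/-!
# SU(2) with free boundary: the open partition function in Bessel form and SLACK-FREE kernel enclosures of the open Wilson loops

HONEST FRAMING: exact (Metropolis-corrected) sampling algorithms for lattice gauge theory;
figures of merit are autocorrelation/cost numbers at stated couplings and volumes; no
continuum-physics claim.

Venture `LatticeQCDFlow` (cell pub-lqcd), sub-topic `Scoring`; FANOUT row 5 (`s0-sun-a`), GEN-12.
NEW WORK of the cell (placement rule); corollaries of `SU2OpenRectangleWilsonLoops` (the exact free-boundary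
area law `⟨½ tr W_{R×T}⟩_{open} = (I₂(2β)/I₁(2β))^{RT}`) and the width-`10⁻²⁰` certificates of
`SU2TorusReferenceEnclosures`:

* `integral_openWeight_su2_two_besselI` — `∫ w_B dHaar^{⊗E} = (e^{−2β} I₁(2β)/β)^{#B}` (`β > 0`);
* `open_wilson_mean_su2a0_loop_encl` — transfer: `lo ≤ I₂(2β)/I₁(2β) ≤ hi` gives
  `lo^{RT} ≤ ⟨½ tr W_{R×T}⟩_{open} ≤ hi^{RT}` with NO finite-size slack;
* **`open_wilson_mean_su2a0_loop_encl20_1p8 / 2p2 / 2p7`** — at the cell's three SU(2) couplings, for EVERY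
  open rectangle (`R₀ + 1 ≤ L`) and every loop inside it:
  `0.39937238005962957259^{RT} ≤ ⟨½tr W_{R×T}⟩_{open, b=1.8} ≤ 0.39937238005962957260^{RT}`,
  `0.46447902527042031065^{RT} ≤ ⟨·⟩_{open, b=2.2} ≤ …066^{RT}`, `0.53297073358967857170^{RT} ≤ ⟨·⟩_{open, b=2.7}
  ≤ …171^{RT}` — the infinite-volume column of the reference table IS the free-boundary value, at any size.

Elementary; nothing is cited; no `def`.
-/

noncomputable section

open Real MeasureTheory Set Function Finset Polynomial.Chebyshev
open Literature.MathematicalPhysics.QuantumFieldTheory Literature.MathematicalPhysics.QuantumLattice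
open Literature.Analysis.FunctionSpaces
open Summit.Ventures.LatticeQCDFlow.Exactness
open Summit.Ventures.LatticeQCDFlow.Theory2.Lattice

namespace Summit.Ventures.LatticeQCDFlow.Scoring

variable {L : ℕ} [NeZero L]

/-- The open-lattice partition function in Bessel form: `∫ w_B dHaar^{⊗E} = (e^{−2β} I₁(2β)/β)^{#B}` (`β > 0`). -/
theorem integral_openWeight_su2_two_besselI {β : ℝ} (hβ : 0 < β) (i j : ZMod L) {R₀ T₀ : ℕ}
    (hR₀ : R₀ + 1 ≤ L) :
    ∫ V, ∏ p : ↥((range R₀ ×ˢ range T₀).image (fun p : ℕ × ℕ => (![i + p.1, j + p.2] : Site 2 L))),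
        Real.exp (-(β * (2 - 2 * su2a0 (plaquetteHolonomy V (p : Site 2 L) 0 1))))
        ∂(Measure.pi fun _ : Edge 2 L => haarProbability (Matrix.specialUnitaryGroup (Fin 2) ℂ)) =
      (Real.exp (-(2 * β)) * besselI 1 (2 * β) / β) ^
        ((range R₀ ×ˢ range T₀).image (fun p : ℕ × ℕ => (![i + p.1, j + p.2] : Site 2 L))).card := by
  rw [integral_openWeight_su2_two hβ.le i j hR₀]
  have h0 := charCoeff_div_succ_eq_besselI 0 hβ.ne'
  simp only [Nat.cast_zero, zero_add, div_one] at h0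
  rw [h0]

/-- **Transfer, slack-free**: an enclosure `lo ≤ I₂(2β)/I₁(2β) ≤ hi` (through `onePlaquetteExpectSU2 (2β) cos`)
gives `lo^{RT} ≤ ⟨½ tr W_{R×T}⟩_{open} ≤ hi^{RT}` for every open rectangle and every loop inside it. -/
theorem open_wilson_mean_su2a0_loop_encl {β b lo hi : ℝ} (hb : 2 * β = b) (hβ : 0 < β) (hlo0 : 0 ≤ lo)
    (he : lo ≤ onePlaquetteExpectSU2 b Real.cos ∧ onePlaquetteExpectSU2 b Real.cos ≤ hi)
    (i j : ZMod L) {R₀ T₀ : ℕ} (hR₀ : R₀ + 1 ≤ L) (i' j' : ZMod L) {R T : ℕ} (hR : 1 ≤ R) (hRL : R ≤ L)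
    (hT : 1 ≤ T) (hTL : T ≤ L)
    (hsub : (range R ×ˢ range T).image (fun p : ℕ × ℕ => (![i' + p.1, j' + p.2] : Site 2 L)) ⊆
      (range R₀ ×ˢ range T₀).image (fun p : ℕ × ℕ => (![i + p.1, j + p.2] : Site 2 L))) :
    lo ^ (R * T) ≤
        (∫ V, su2a0 (((List.range R).map fun a : ℕ => V (![i' + a, j'], 0)).prod *
              ((List.range T).map fun b : ℕ => V (![i' + R, j' + b], 1)).prod *
              (((List.range R).map fun a : ℕ => V (![i' + a, j' + T], 0)).prod)⁻¹ *
              (((List.range T).map fun b : ℕ => V (![i', j' + b], 1)).prod)⁻¹) *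
          ∏ p : ↥((range R₀ ×ˢ range T₀).image (fun p : ℕ × ℕ => (![i + p.1, j + p.2] : Site 2 L))),
            Real.exp (-(β * (2 - 2 * su2a0 (plaquetteHolonomy V (p : Site 2 L) 0 1))))
          ∂(Measure.pi fun _ : Edge 2 L => haarProbability (Matrix.specialUnitaryGroup (Fin 2) ℂ))) /
        (∫ V, ∏ p : ↥((range R₀ ×ˢ range T₀).image (fun p : ℕ × ℕ => (![i + p.1, j + p.2] : Site 2 L))),
            Real.exp (-(β * (2 - 2 * su2a0 (plaquetteHolonomy V (p : Site 2 L) 0 1))))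
          ∂(Measure.pi fun _ : Edge 2 L => haarProbability (Matrix.specialUnitaryGroup (Fin 2) ℂ))) ∧
      (∫ V, su2a0 (((List.range R).map fun a : ℕ => V (![i' + a, j'], 0)).prod *
              ((List.range T).map fun b : ℕ => V (![i' + R, j' + b], 1)).prod *
              (((List.range R).map fun a : ℕ => V (![i' + a, j' + T], 0)).prod)⁻¹ *
              (((List.range T).map fun b : ℕ => V (![i', j' + b], 1)).prod)⁻¹) *
          ∏ p : ↥((range R₀ ×ˢ range T₀).image (fun p : ℕ × ℕ => (![i + p.1, j + p.2] : Site 2 L))),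
            Real.exp (-(β * (2 - 2 * su2a0 (plaquetteHolonomy V (p : Site 2 L) 0 1))))
          ∂(Measure.pi fun _ : Edge 2 L => haarProbability (Matrix.specialUnitaryGroup (Fin 2) ℂ))) /
        (∫ V, ∏ p : ↥((range R₀ ×ˢ range T₀).image (fun p : ℕ × ℕ => (![i + p.1, j + p.2] : Site 2 L))),
            Real.exp (-(β * (2 - 2 * su2a0 (plaquetteHolonomy V (p : Site 2 L) 0 1))))
          ∂(Measure.pi fun _ : Edge 2 L => haarProbability (Matrix.specialUnitaryGroup (Fin 2) ℂ))) ≤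
        hi ^ (R * T) := by
  rw [open_wilson_mean_su2a0_loop_two hβ i j hR₀ i' j' hR hRL hT hTL hsub, hb,
    ← onePlaquetteExpectSU2_cos_eq_besselI_div]
  exact ⟨pow_le_pow_left₀ hlo0 he.1 _, pow_le_pow_left₀ (hlo0.trans he.1) he.2 _⟩

/-- **Free boundary, `b = 2β = 1.8`**: `0.39937238005962957259^{RT} ≤ ⟨½ tr W_{R×T}⟩_{open} ≤ 0.39937238005962957260^{RT}`
for every open rectangle and every loop inside it. -/
theorem open_wilson_mean_su2a0_loop_encl20_1p8 (i j : ZMod L) {R₀ T₀ : ℕ} (hR₀ : R₀ + 1 ≤ L) (i' j' : ZMod L)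
    {R T : ℕ} (hR : 1 ≤ R) (hRL : R ≤ L) (hT : 1 ≤ T) (hTL : T ≤ L)
    (hsub : (range R ×ˢ range T).image (fun p : ℕ × ℕ => (![i' + p.1, j' + p.2] : Site 2 L)) ⊆
      (range R₀ ×ˢ range T₀).image (fun p : ℕ × ℕ => (![i + p.1, j + p.2] : Site 2 L))) :
    ((39937238005962957259 : ℝ) / 100000000000000000000) ^ (R * T) ≤
        (∫ V, su2a0 (((List.range R).map fun a : ℕ => V (![i' + a, j'], 0)).prod *
              ((List.range T).map fun b : ℕ => V (![i' + R, j' + b], 1)).prod *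
              (((List.range R).map fun a : ℕ => V (![i' + a, j' + T], 0)).prod)⁻¹ *
              (((List.range T).map fun b : ℕ => V (![i', j' + b], 1)).prod)⁻¹) *
          ∏ p : ↥((range R₀ ×ˢ range T₀).image (fun p : ℕ × ℕ => (![i + p.1, j + p.2] : Site 2 L))),
            Real.exp (-((9 / 10 : ℝ) * (2 - 2 * su2a0 (plaquetteHolonomy V (p : Site 2 L) 0 1))))
          ∂(Measure.pi fun _ : Edge 2 L => haarProbability (Matrix.specialUnitaryGroup (Fin 2) ℂ))) /
        (∫ V, ∏ p : ↥((range R₀ ×ˢ range T₀).image (fun p : ℕ × ℕ => (![i + p.1, j + p.2] : Site 2 L))),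
            Real.exp (-((9 / 10 : ℝ) * (2 - 2 * su2a0 (plaquetteHolonomy V (p : Site 2 L) 0 1))))
          ∂(Measure.pi fun _ : Edge 2 L => haarProbability (Matrix.specialUnitaryGroup (Fin 2) ℂ))) ∧
      (∫ V, su2a0 (((List.range R).map fun a : ℕ => V (![i' + a, j'], 0)).prod *
              ((List.range T).map fun b : ℕ => V (![i' + R, j' + b], 1)).prod *
              (((List.range R).map fun a : ℕ => V (![i' + a, j' + T], 0)).prod)⁻¹ *
              (((List.range T).map fun b : ℕ => V (![i', j' + b], 1)).prod)⁻¹) *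
          ∏ p : ↥((range R₀ ×ˢ range T₀).image (fun p : ℕ × ℕ => (![i + p.1, j + p.2] : Site 2 L))),
            Real.exp (-((9 / 10 : ℝ) * (2 - 2 * su2a0 (plaquetteHolonomy V (p : Site 2 L) 0 1))))
          ∂(Measure.pi fun _ : Edge 2 L => haarProbability (Matrix.specialUnitaryGroup (Fin 2) ℂ))) /
        (∫ V, ∏ p : ↥((range R₀ ×ˢ range T₀).image (fun p : ℕ × ℕ => (![i + p.1, j + p.2] : Site 2 L))),
            Real.exp (-((9 / 10 : ℝ) * (2 - 2 * su2a0 (plaquetteHolonomy V (p : Site 2 L) 0 1))))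
          ∂(Measure.pi fun _ : Edge 2 L => haarProbability (Matrix.specialUnitaryGroup (Fin 2) ℂ))) ≤
        ((39937238005962957260 : ℝ) / 100000000000000000000) ^ (R * T) :=
  open_wilson_mean_su2a0_loop_encl (by norm_num) (by norm_num) (by norm_num) onePlaquetteExpectSU2_cos_encl20_1p8
    i j hR₀ i' j' hR hRL hT hTL hsub

/-- **Free boundary, `b = 2β = 2.2`** (the S0-C-02 coupling): `0.46447902527042031065^{RT} ≤ ⟨½ tr W_{R×T}⟩_{open} ≤
0.46447902527042031066^{RT}` for every open rectangle and every loop inside it. -/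
theorem open_wilson_mean_su2a0_loop_encl20_2p2 (i j : ZMod L) {R₀ T₀ : ℕ} (hR₀ : R₀ + 1 ≤ L) (i' j' : ZMod L)
    {R T : ℕ} (hR : 1 ≤ R) (hRL : R ≤ L) (hT : 1 ≤ T) (hTL : T ≤ L)
    (hsub : (range R ×ˢ range T).image (fun p : ℕ × ℕ => (![i' + p.1, j' + p.2] : Site 2 L)) ⊆
      (range R₀ ×ˢ range T₀).image (fun p : ℕ × ℕ => (![i + p.1, j + p.2] : Site 2 L))) :
    ((46447902527042031065 : ℝ) / 100000000000000000000) ^ (R * T) ≤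
        (∫ V, su2a0 (((List.range R).map fun a : ℕ => V (![i' + a, j'], 0)).prod *
              ((List.range T).map fun b : ℕ => V (![i' + R, j' + b], 1)).prod *
              (((List.range R).map fun a : ℕ => V (![i' + a, j' + T], 0)).prod)⁻¹ *
              (((List.range T).map fun b : ℕ => V (![i', j' + b], 1)).prod)⁻¹) *
          ∏ p : ↥((range R₀ ×ˢ range T₀).image (fun p : ℕ × ℕ => (![i + p.1, j + p.2] : Site 2 L))),
            Real.exp (-((11 / 10 : ℝ) * (2 - 2 * su2a0 (plaquetteHolonomy V (p : Site 2 L) 0 1))))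
          ∂(Measure.pi fun _ : Edge 2 L => haarProbability (Matrix.specialUnitaryGroup (Fin 2) ℂ))) /
        (∫ V, ∏ p : ↥((range R₀ ×ˢ range T₀).image (fun p : ℕ × ℕ => (![i + p.1, j + p.2] : Site 2 L))),
            Real.exp (-((11 / 10 : ℝ) * (2 - 2 * su2a0 (plaquetteHolonomy V (p : Site 2 L) 0 1))))
          ∂(Measure.pi fun _ : Edge 2 L => haarProbability (Matrix.specialUnitaryGroup (Fin 2) ℂ))) ∧
      (∫ V, su2a0 (((List.range R).map fun a : ℕ => V (![i' + a, j'], 0)).prod *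
              ((List.range T).map fun b : ℕ => V (![i' + R, j' + b], 1)).prod *
              (((List.range R).map fun a : ℕ => V (![i' + a, j' + T], 0)).prod)⁻¹ *
              (((List.range T).map fun b : ℕ => V (![i', j' + b], 1)).prod)⁻¹) *
          ∏ p : ↥((range R₀ ×ˢ range T₀).image (fun p : ℕ × ℕ => (![i + p.1, j + p.2] : Site 2 L))),
            Real.exp (-((11 / 10 : ℝ) * (2 - 2 * su2a0 (plaquetteHolonomy V (p : Site 2 L) 0 1))))
          ∂(Measure.pi fun _ : Edge 2 L => haarProbability (Matrix.specialUnitaryGroup (Fin 2) ℂ))) /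
        (∫ V, ∏ p : ↥((range R₀ ×ˢ range T₀).image (fun p : ℕ × ℕ => (![i + p.1, j + p.2] : Site 2 L))),
            Real.exp (-((11 / 10 : ℝ) * (2 - 2 * su2a0 (plaquetteHolonomy V (p : Site 2 L) 0 1))))
          ∂(Measure.pi fun _ : Edge 2 L => haarProbability (Matrix.specialUnitaryGroup (Fin 2) ℂ))) ≤
        ((46447902527042031066 : ℝ) / 100000000000000000000) ^ (R * T) :=
  open_wilson_mean_su2a0_loop_encl (by norm_num) (by norm_num) (by norm_num) onePlaquetteExpectSU2_cos_encl20_2p2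
    i j hR₀ i' j' hR hRL hT hTL hsub

/-- **Free boundary, `b = 2β = 2.7`**: `0.53297073358967857170^{RT} ≤ ⟨½ tr W_{R×T}⟩_{open} ≤ 0.53297073358967857171^{RT}`
for every open rectangle and every loop inside it. -/
theorem open_wilson_mean_su2a0_loop_encl20_2p7 (i j : ZMod L) {R₀ T₀ : ℕ} (hR₀ : R₀ + 1 ≤ L) (i' j' : ZMod L)
    {R T : ℕ} (hR : 1 ≤ R) (hRL : R ≤ L) (hT : 1 ≤ T) (hTL : T ≤ L)
    (hsub : (range R ×ˢ range T).image (fun p : ℕ × ℕ => (![i' + p.1, j' + p.2] : Site 2 L)) ⊆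
      (range R₀ ×ˢ range T₀).image (fun p : ℕ × ℕ => (![i + p.1, j + p.2] : Site 2 L))) :
    ((53297073358967857170 : ℝ) / 100000000000000000000) ^ (R * T) ≤
        (∫ V, su2a0 (((List.range R).map fun a : ℕ => V (![i' + a, j'], 0)).prod *
              ((List.range T).map fun b : ℕ => V (![i' + R, j' + b], 1)).prod *
              (((List.range R).map fun a : ℕ => V (![i' + a, j' + T], 0)).prod)⁻¹ *
              (((List.range T).map fun b : ℕ => V (![i', j' + b], 1)).prod)⁻¹) *
          ∏ p : ↥((range R₀ ×ˢ range T₀).image (fun p : ℕ × ℕ => (![i + p.1, j + p.2] : Site 2 L))),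
            Real.exp (-((27 / 20 : ℝ) * (2 - 2 * su2a0 (plaquetteHolonomy V (p : Site 2 L) 0 1))))
          ∂(Measure.pi fun _ : Edge 2 L => haarProbability (Matrix.specialUnitaryGroup (Fin 2) ℂ))) /
        (∫ V, ∏ p : ↥((range R₀ ×ˢ range T₀).image (fun p : ℕ × ℕ => (![i + p.1, j + p.2] : Site 2 L))),
            Real.exp (-((27 / 20 : ℝ) * (2 - 2 * su2a0 (plaquetteHolonomy V (p : Site 2 L) 0 1))))
          ∂(Measure.pi fun _ : Edge 2 L => haarProbability (Matrix.specialUnitaryGroup (Fin 2) ℂ))) ∧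
      (∫ V, su2a0 (((List.range R).map fun a : ℕ => V (![i' + a, j'], 0)).prod *
              ((List.range T).map fun b : ℕ => V (![i' + R, j' + b], 1)).prod *
              (((List.range R).map fun a : ℕ => V (![i' + a, j' + T], 0)).prod)⁻¹ *
              (((List.range T).map fun b : ℕ => V (![i', j' + b], 1)).prod)⁻¹) *
          ∏ p : ↥((range R₀ ×ˢ range T₀).image (fun p : ℕ × ℕ => (![i + p.1, j + p.2] : Site 2 L))),
            Real.exp (-((27 / 20 : ℝ) * (2 - 2 * su2a0 (plaquetteHolonomy V (p : Site 2 L) 0 1))))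
          ∂(Measure.pi fun _ : Edge 2 L => haarProbability (Matrix.specialUnitaryGroup (Fin 2) ℂ))) /
        (∫ V, ∏ p : ↥((range R₀ ×ˢ range T₀).image (fun p : ℕ × ℕ => (![i + p.1, j + p.2] : Site 2 L))),
            Real.exp (-((27 / 20 : ℝ) * (2 - 2 * su2a0 (plaquetteHolonomy V (p : Site 2 L) 0 1))))
          ∂(Measure.pi fun _ : Edge 2 L => haarProbability (Matrix.specialUnitaryGroup (Fin 2) ℂ))) ≤
        ((53297073358967857171 : ℝ) / 100000000000000000000) ^ (R * T) :=
  open_wilson_mean_su2a0_loop_encl (by norm_num) (by norm_num) (by norm_num) onePlaquetteExpectSU2_cos_encl20_2p7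
    i j hR₀ i' j' hR hRL hT hTL hsub

end Summit.Ventures.LatticeQCDFlow.Scoring
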